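import Summits.HodgeConjecture.HodgeCM.Model.EndStateLevelMeet_1

/-! PORT of `HodgeCM/Model/EndStateLevelMeet.lean` (HodgeCMPerL run 82) — part 2: continuation of `Summits.HodgeConjecture.HodgeCM.Model.EndStateLevelMeet_1` (split at a top-level declaration boundary by port_pkg.py; scope re-opened below; declarations unchanged). -/

-- port_pkg: scope re-opened for this part (file-level context, then the namespace/section stack open at the cut)
noncomputable section
open scoped TensorProduct InnerProductSpace Matrix
namespace HodgeCM
open Literature.AlgebraicGeometry.Motives (CMType HodgeStructure)
open Literature.AlgebraicGeometry.Motives.HodgeStructure (conj)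
open HodgeCM.Prior.Perl34File
namespace Universe
variable (U : Universe)
variable {U}
namespace ThetaModel
variable (T : U.ThetaModel)
variable {T}
variable (T)
variable {T}
/-- The global record of record restricts to the E2″ record for every class `S`. -/
theorem AllCharsNonDesign.pt (A : T.AllCharsNonDesign) (S : ∀ {L : CMField}, SeesawCtx L → Prop) :
    T.AllCharsNonDesignPt S :=
  ⟨fun _ _ _ _ Γ Γ' h η => A.embCover Γ Γ' h η, fun _ _ _ _ Γ => A.innerEmb Γ, fun V c hc _ => A.thetaSub V c hc,
    fun V c hc _ => A.thetaWedge V c hc, fun V c hc _ => A.thetaGen12All V c hc,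
    fun V c hc _ => A.thetaReal34All V c hc, fun V c hc _ => A.occ V c hc⟩

/-- The global E3 record restricts to the pointwise one for every class `S`. -/
theorem AllCharsNonDesign₁.pt (A : T.AllCharsNonDesign₁) (S : ∀ {L : CMField}, SeesawCtx L → Prop) :
    T.AllCharsNonDesignPt₁ S :=
  ⟨fun V c hc _ => A.levelMeet V c hc, fun _ _ _ _ Γ => A.innerEmb Γ, fun V c hc _ => A.thetaSub V c hc,
    fun V c hc _ => A.thetaWedge V c hc, fun V c hc _ => A.thetaGen12All V c hc,
    fun V c hc _ => A.thetaReal34All V c hc, fun V c hc _ => A.occ V c hc⟩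

/-- Monotonicity in the class. -/
theorem AllCharsNonDesignPt₁.mono {S S' : ∀ {L : CMField}, SeesawCtx L → Prop} (A : T.AllCharsNonDesignPt₁ S)
    (hSS' : ∀ {L : CMField} (c : SeesawCtx L), S' c → S c) : T.AllCharsNonDesignPt₁ S' :=
  ⟨fun V c hc h => A.levelMeet V c hc (hSS' c h), fun V c hc h => A.innerEmb V c hc (hSS' c h),
    fun V c hc h => A.thetaSub V c hc (hSS' c h), fun V c hc h => A.thetaWedge V c hc (hSS' c h),
    fun V c hc h => A.thetaGen12All V c hc (hSS' c h), fun V c hc h => A.thetaReal34All V c hc (hSS' c h),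
    fun V c hc h => A.occ V c hc (hSS' c h)⟩

end ThetaModel

/-! ## 4. The realisation open inputs, level-meeting form -/

variable (U) in
/-- `RealisationExistsPerL` (`StubTree/Inputs.lean:82`) with `ThetaRealisation₁` for `ThetaRealisation`. -/
def RealisationExistsPerL₁ : Prop :=
  ∀ (K L : CMField) (j : K →+* L), IsNormalClosure ℚ K L →
    Module.finrank ℚ K = 6 → (Module.finrank ℚ L = 24 ∨ Module.finrank ℚ L = 48) →
    ∀ (φ : Fin 3 → (K →+* ℂ)), IsFrame φ →
    ∀ (ι₁ : L →+* ℂ), ι₁.comp j = φ 0 →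
    ∀ (t : Fin 4 → CMType K), IsPerLTypes φ t →
    ∀ (V : HermSpace3 L ι₁), Nonempty (U.ThetaRealisation₁ ι₁ V K t (φ 0))

variable (U) in
/-- `RealisationExistsFace` (`StubTree/Inputs.lean:97`) with `ThetaRealisation₁` for `ThetaRealisation`. -/
def RealisationExistsFace₁ : Prop :=
  ∀ (F : CMField), IsGalois ℚ F → 6 ≤ Module.finrank ℚ F →
    ∀ (f : Face F) (ι₁ : F →+* ℂ), f.Admissible ι₁ →
    ∀ (V : HermSpace3 F ι₁), Nonempty (U.ThetaRealisation₁ ι₁ V F f.psi ι₁)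

/-- MONOTONICITY: the open input of record gives the level-meeting one. -/
theorem RealisationExistsPerL.toMeet (hpc : U.Fact_pull_comp) (h : U.RealisationExistsPerL) :
    U.RealisationExistsPerL₁ :=
  fun K L j hN hK hL φ hφ ι₁ hι t ht V => ⟨(Classical.choice (h K L j hN hK hL φ hφ ι₁ hι t ht V)).toMeet hpc⟩

namespace ModelAxiomsPerL

/-! ## 5. The constructions and the PerL path over the five facts, level-meeting form -/

/-- **The level-meeting theta realisation at ONE context `(V, c)`, over the five facts** —
`nonempty_thetaRealisation_at` with the hypothesis `h₁` (body of `Fact_embCover` at `V`) replaced by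
`h₁ : T.LevelMeetAt V c`; `h₂ = T.InnerEmbAt V` (body of `Fact_innerEmb` at `V`) and the six open-input bodies
`h₅ … h₁₀` VERBATIM. -/
theorem nonempty_thetaRealisation₁_at (M : U.ModelAxiomsPerL) (T : U.ThetaModel) (hHR : U.Fact_hodgeRiemann20)
    {L : CMField} {ι₁ : L →+* ℂ} (V : HermSpace3 L ι₁) (c : SeesawCtx L) (h₁ : T.LevelMeetAt V c)
    (h₂ : T.InnerEmbAt V)
    (h₅ : ∀ (i : Fin 4) (Γ : Level V), T.Theta V c i Γ ⊆ U.Uiso Γ c.K (c.Ψ i) c.σ)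
    (h₆ : ∃ Γ : Level V, ∃ ω₁ ∈ T.Theta V c 0 Γ, ∃ ω₂ ∈ T.Theta V c 1 Γ, U.cup2C (U.pms L ι₁ V Γ) 1 ω₁ ω₂ ≠ 0)
    (h₇ : ∀ (Γ : Level V) (ω₁ ω₂ : U.CohC (U.pms L ι₁ V Γ) 1), ω₁ ∈ T.Theta V c 0 Γ → ω₂ ∈ T.Theta V c 1 Γ →
      T.Λ Γ ω₁ ω₂ ∈ (T.t12 V c).S12)
    (h₈ : ∀ χ : (T.t34 V c).X, (T.t34 V c).allowed χ → ∀ Φ : T.SK V c,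
      (T.t34 V c).ϑ χ Φ ∈ (Submodule.span ℂ (T.wedgeSet V c 2 3)).topologicalClosure)
    (h₉ : (∀ χ : (T.t12 V c).X, (T.t12 V c).allowed χ) ∧ (∀ χ : (T.t34 V c).X, (T.t34 V c).allowed χ))
    (h₁₀ : (∀ (Φ : T.SK V c) (i : T.SigIdx V c),
        (∃ v ∈ (T.core V c).hatσ i, (T.core V c).TΦ Φ v ≠ 0) → (T.t12 V c).wOccurs i) ∧
      (∀ (Φ : T.SK V c) (i : T.SigIdx V c),
        (∃ v ∈ (T.core V c).hatσ i, (T.core V c).TΦ Φ v ≠ 0) → (T.t34 V c).wOccurs i)) :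
    Nonempty (U.ThetaRealisation₁ ι₁ V c.K c.Ψ c.σ) := by
  have hH10 : ∀ (i : Fin 4) (Γ : Level V), ∀ ω ∈ T.Theta V c i Γ, ω ∈ U.H10 (U.pms L ι₁ V Γ) :=
    fun i Γ ω hω => U.Uiso_le_H10 M.pull_hodge Γ c.K (c.Ψ i) c.σ (h₅ i Γ hω)
  refine ⟨{
    H := T.H V c
    HG := T.HG L ι₁ V
    CG := T.CG V c
    G := T.G V c
    SK := T.SK V c
    SigIdx := T.SigIdx V c
    SigIdxG := T.SigIdxG V c
    S := { core := T.core V c, t12 := T.t12 V c, t34 := T.t34 V c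
           H_chars12 := h₉.1, H_chars34 := h₉.2
           H_occ12 := h₁₀.1, H_occ34 := h₁₀.2 }
    Λ := fun Γ => T.Λ Γ
    Theta := fun i Γ => T.Theta V c i Γ
    Theta_sub := fun i Γ => h₅ i Γ
    lineField := ?_
    gen12 := fun Γ ω₁ ω₂ e₁ e₂ => h₇ Γ ω₁ ω₂ e₁ e₂
    real34 := fun χ hχ Φ => h₈ χ hχ Φ
    Λ_meet := fun Γ₁ Γ₂ ω₁ ω₂ ω₃ ω₄ e₁ e₂ e₃ e₄ hne => h₁ Γ₁ Γ₂ ω₁ ω₂ ω₃ ω₄ e₁ e₂ e₃ e₄ hne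
    inner_Λ := ?_ }⟩
  · -- Prop 4.3 on forms ⇒ on L² functions (Hodge–Riemann)
    obtain ⟨Γ, ω₁, e₁, ω₂, e₂, hne⟩ := h₆
    exact ⟨Γ, ω₁, e₁, ω₂, e₂,
      emb_ne_zero_at M T Γ (h₂ Γ) hHR (cup2C_mem_F2 M _ (hH10 0 Γ ω₁ e₁) (hH10 1 Γ ω₂ e₂)) hne⟩
  · -- Petersson = period
    intro Γ
    obtain ⟨c₀, hc₀, h⟩ := h₂ Γ
    refine ⟨c₀, hc₀, fun ω hω => ?_⟩
    show ⟪T.emb Γ (U.cup2C _ 1 (ω 2) (ω 3)), T.emb Γ (U.cup2C _ 1 (ω 0) (ω 1))⟫_ℂ = c₀ * U.period _ ω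
    rw [h _ _ (cup2C_mem_F2 M _ (hω 0) (hω 1)) (cup2C_mem_F2 M _ (hω 2) (hω 3)), conj_cup2C _ 1]
    rfl

/-- **Pointwise construction, all-characters form** (no `chars` hypothesis): the `S₁₂^all`-target body `h₇` and
the every-character reality body `h₈` suffice — the realisation is built for `T.allChars` at `(V, c)`
(`TorusData.allChars_S12`; all other data of `T.allChars` are those of `T` by `rfl`). -/
theorem nonempty_thetaRealisation₁_at_allChars (M : U.ModelAxiomsPerL) (T : U.ThetaModel)
    (hHR : U.Fact_hodgeRiemann20) {L : CMField} {ι₁ : L →+* ℂ} (V : HermSpace3 L ι₁) (c : SeesawCtx L)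
    (h₁ : T.LevelMeetAt V c) (h₂ : T.InnerEmbAt V)
    (h₅ : ∀ (i : Fin 4) (Γ : Level V), T.Theta V c i Γ ⊆ U.Uiso Γ c.K (c.Ψ i) c.σ)
    (h₆ : ∃ Γ : Level V, ∃ ω₁ ∈ T.Theta V c 0 Γ, ∃ ω₂ ∈ T.Theta V c 1 Γ, U.cup2C (U.pms L ι₁ V Γ) 1 ω₁ ω₂ ≠ 0)
    (h₇ : ∀ (Γ : Level V) (ω₁ ω₂ : U.CohC (U.pms L ι₁ V Γ) 1), ω₁ ∈ T.Theta V c 0 Γ → ω₂ ∈ T.Theta V c 1 Γ →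
      T.Λ Γ ω₁ ω₂ ∈ (Submodule.span ℂ
        {u : T.HG L ι₁ V | ∃ (χ : (T.t12 V c).X) (Φ : T.SK V c), u = (T.t12 V c).ϑ χ Φ}).topologicalClosure)
    (h₈ : ∀ (χ : (T.t34 V c).X) (Φ : T.SK V c),
      (T.t34 V c).ϑ χ Φ ∈ (Submodule.span ℂ (T.wedgeSet V c 2 3)).topologicalClosure)
    (h₁₀ : (∀ (Φ : T.SK V c) (i : T.SigIdx V c),
        (∃ v ∈ (T.core V c).hatσ i, (T.core V c).TΦ Φ v ≠ 0) → (T.t12 V c).wOccurs i) ∧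
      (∀ (Φ : T.SK V c) (i : T.SigIdx V c),
        (∃ v ∈ (T.core V c).hatσ i, (T.core V c).TΦ Φ v ≠ 0) → (T.t34 V c).wOccurs i)) :
    Nonempty (U.ThetaRealisation₁ ι₁ V c.K c.Ψ c.σ) :=
  nonempty_thetaRealisation₁_at M T.allChars hHR V c h₁ h₂ h₅ h₆
    (fun Γ ω₁ ω₂ e₁ e₂ => by
      show T.Λ Γ ω₁ ω₂ ∈ ((T.t12 V c).allChars).S12
      rw [Prior.Perl34File.Perl34.TorusData.allChars_S12]
      exact h₇ Γ ω₁ ω₂ e₁ e₂)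
    (fun χ _ Φ => h₈ χ Φ) ⟨fun _ => trivial, fun _ => trivial⟩ h₁₀

/-- The same from the good-context data of a forced-sign seesaw datum (= `nonempty_thetaRealisation_of_seesaw` with
the eight inputs unbundled and `embCover ↦ levelMeet`). -/
theorem nonempty_thetaRealisation₁_of_seesaw (M : U.ModelAxiomsPerL) (T : U.ThetaModel)
    (hHR : U.Fact_hodgeRiemann20) (hLM : T.Open_levelMeet) (hI : T.Fact_innerEmb) (hS : T.Open_thetaSub)
    (hW : T.Open_thetaWedge) (hG : T.Open_thetaGen12) (hR : T.Open_thetaReal34) (hC : T.Open_chars)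
    (hO : T.Open_occ) {K L : CMField} (j : K →+* L) (ι₁ : L →+* ℂ)
    (Ψ : Fin 4 → CMType K) (σ : K →+* ℂ) (hσ : ι₁.comp j = σ) (hΨ : PairSum Ψ)
    (hinj : Function.Injective Ψ) (hmem : ∀ i, σ ∈ (Ψ i).1) (V : HermSpace3 L ι₁)
    (D : StubTree.SeesawDatum L) (hD : T.SignsForced K L j ι₁ Ψ D) :
    Nonempty (U.ThetaRealisation₁ ι₁ V K Ψ σ) := by
  let c : SeesawCtx L := ⟨K, Ψ, σ, D⟩
  have hc : T.GoodCtx ι₁ c := ⟨hΨ, hinj, hmem, ⟨j, hσ, hD⟩⟩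
  exact nonempty_thetaRealisation₁_at M T hHR V c (hLM V c hc) (fun Γ => hI Γ) (hS V c hc) (hW V c hc)
    (hG V c hc) (hR V c hc) (hC V c hc) (hO V c hc)

/-- The same with the seesaw datum discharged in-package (`exists_seesawDatum_constructed`, from the two design
constraints). -/
theorem nonempty_thetaRealisation₁'' (M : U.ModelAxiomsPerL) (T : U.ThetaModel)
    (hHR : U.Fact_hodgeRiemann20) (hLM : T.Open_levelMeet) (hI : T.Fact_innerEmb) (hS : T.Open_thetaSub)
    (hW : T.Open_thetaWedge) (hG : T.Open_thetaGen12) (hR : T.Open_thetaReal34) (hC : T.Open_chars)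
    (hO : T.Open_occ) (hκ : T.Design_kappaConj) (hs : T.Design_frameSignConj) {K L : CMField} (j : K →+* L)
    (ι₁ : L →+* ℂ) (Ψ : Fin 4 → CMType K) (σ : K →+* ℂ) (hσ : ι₁.comp j = σ) (hΨ : PairSum Ψ)
    (hinj : Function.Injective Ψ) (hmem : ∀ i, σ ∈ (Ψ i).1) (V : HermSpace3 L ι₁) :
    Nonempty (U.ThetaRealisation₁ ι₁ V K Ψ σ) := by
  obtain ⟨D, hD⟩ := T.exists_seesawDatum_constructed hκ hs j ι₁ Ψ hΨ
  exact nonempty_thetaRealisation₁_of_seesaw M T hHR hLM hI hS hW hG hR hC hO j ι₁ Ψ σ hσ hΨ hinj hmem V D hD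

/-- PerL Thm 4.4 from the level-meeting open input. -/
theorem perL44_holds₁ (M : U.ModelAxiomsPerL) (hR : U.RealisationExistsPerL₁) : U.PerL44 := by
  intro K L j hN hK hL φ hφ ι₁ hι t ht V
  obtain ⟨R⟩ := hR K L j hN hK hL φ hφ ι₁ hι t ht V
  exact thm44_of_realisation₁ M R

/-- **`W_per^L` from the level-meeting open input** (Landherr existence in-package, `StubTree.landherr_exists`). -/
theorem perL₁ (M : U.ModelAxiomsPerL) (hR : U.RealisationExistsPerL₁) : U.PerL :=
  Assembly.perL_of_perL44 U StubTree.landherr_exists (perL44_holds₁ M hR)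

/-- The level-meeting open input, PerL setting, from the eight unbundled inputs and the two design constraints. -/
theorem realisationExistsPerL₁_of'' (M : U.ModelAxiomsPerL) (T : U.ThetaModel) (hHR : U.Fact_hodgeRiemann20)
    (hLM : T.Open_levelMeet) (hI : T.Fact_innerEmb) (hS : T.Open_thetaSub) (hW : T.Open_thetaWedge)
    (hG : T.Open_thetaGen12) (hR : T.Open_thetaReal34) (hC : T.Open_chars) (hO : T.Open_occ)
    (hκ : T.Design_kappaConj) (hs : T.Design_frameSignConj) : U.RealisationExistsPerL₁ := by
  intro K L j _ hK _ φ hφ ι₁ hι₁ t ht V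
  have hmem : ∀ i, φ 0 ∈ (t i).1 := fun i => (ht i 0).mpr (by fin_cases i <;> rfl)
  exact nonempty_thetaRealisation₁'' M T hHR hLM hI hS hW hG hR hC hO hκ hs j ι₁ t (φ 0) hι₁
    (StubTree.pairSum_of_isPerLTypes K φ hφ hK t ht) (StubTree.injective_of_isPerLTypes K φ hφ t ht) hmem V

/-- The level-meeting open input, face setting (not on the PerL path; carried as the end state of record does). -/
theorem realisationExistsFace₁_of'' (M : U.ModelAxiomsPerL) (T : U.ThetaModel) (hHR : U.Fact_hodgeRiemann20)
    (hLM : T.Open_levelMeet) (hI : T.Fact_innerEmb) (hS : T.Open_thetaSub) (hW : T.Open_thetaWedge)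
    (hG : T.Open_thetaGen12) (hR : T.Open_thetaReal34) (hC : T.Open_chars) (hO : T.Open_occ)
    (hκ : T.Design_kappaConj) (hs : T.Design_frameSignConj) : U.RealisationExistsFace₁ := by
  intro F _ _ f ι₁ hadm V
  exact nonempty_thetaRealisation₁'' M T hHR hLM hI hS hW hG hR hC hO hκ hs (RingHom.id F) ι₁ f.psi ι₁
    (RingHom.comp_id ι₁) (pairSum_psi f) (StubTree.psi_injective F f) (admissible_mem_psi f ι₁ hadm) V

/-- **PerL from the seven level-meeting all-characters inputs** (= `perL_allChars` with `embCover ↦ levelMeet`;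
the passage through `T.allChars` is the one of record, `allChars_*_iff`). -/
theorem perL_allChars₁ (M : U.ModelAxiomsPerL) (T : U.ThetaModel) (A : T.AllCharsNonDesign₁)
    (hκ : T.Design_kappaConj) (hs : T.Design_frameSignConj) (hHR : U.Fact_hodgeRiemann20) : U.PerL :=
  perL₁ M (realisationExistsPerL₁_of'' M T.allChars hHR ((T.allChars_levelMeet_iff).mpr A.levelMeet) A.innerEmb
    ((T.allChars_thetaSub_iff).mpr A.thetaSub) ((T.allChars_thetaWedge_iff).mpr A.thetaWedge)
    ((T.allChars_thetaGen12_iff).mpr A.thetaGen12All) ((T.allChars_thetaReal34_iff).mpr A.thetaReal34All)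
    T.allChars_chars ((T.allChars_occ_iff).mpr A.occ) hκ hs)

/-- Both level-meeting realisation inputs from the seven inputs and the two design constraints. -/
theorem realisationExists_allChars₁ (M : U.ModelAxiomsPerL) (T : U.ThetaModel) (A : T.AllCharsNonDesign₁)
    (hκ : T.Design_kappaConj) (hs : T.Design_frameSignConj) (hHR : U.Fact_hodgeRiemann20) :
    U.RealisationExistsPerL₁ ∧ U.RealisationExistsFace₁ :=
  ⟨realisationExistsPerL₁_of'' M T.allChars hHR ((T.allChars_levelMeet_iff).mpr A.levelMeet) A.innerEmb
      ((T.allChars_thetaSub_iff).mpr A.thetaSub) ((T.allChars_thetaWedge_iff).mpr A.thetaWedge)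
      ((T.allChars_thetaGen12_iff).mpr A.thetaGen12All) ((T.allChars_thetaReal34_iff).mpr A.thetaReal34All)
      T.allChars_chars ((T.allChars_occ_iff).mpr A.occ) hκ hs,
    realisationExistsFace₁_of'' M T.allChars hHR ((T.allChars_levelMeet_iff).mpr A.levelMeet) A.innerEmb
      ((T.allChars_thetaSub_iff).mpr A.thetaSub) ((T.allChars_thetaWedge_iff).mpr A.thetaWedge)
      ((T.allChars_thetaGen12_iff).mpr A.thetaGen12All) ((T.allChars_thetaReal34_iff).mpr A.thetaReal34All)
      T.allChars_chars ((T.allChars_occ_iff).mpr A.occ) hκ hs⟩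

/-! ### The PerL path from the POINTWISE records (J-SAN final + FIX 1) -/

/-- **`RealisationExistsPerL₁` from the pointwise E3 record on any class `S` containing the SEXTIC contexts**
(+ the five facts, the two design constraints, Hodge–Riemann; NO `chars` input): PerL's realisation at
`(K, L, j, φ, ι₁, t, V)` is built at the context `⟨K, t, φ 0, D⟩`, `D` the CONSTRUCTED forced-sign seesaw datum
(`exists_seesawDatum_constructed`), from the seven input bodies AT that context and AT that `V` only. -/
theorem realisationExistsPerL₁_of_pt (M : U.ModelAxiomsPerL) (T : U.ThetaModel) (hHR : U.Fact_hodgeRiemann20)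
    (hκ : T.Design_kappaConj) (hs : T.Design_frameSignConj) {S : ∀ {L : CMField}, SeesawCtx L → Prop}
    (hS : ∀ {L : CMField} (c : SeesawCtx L), Module.finrank ℚ c.K = 6 → S c) (A : T.AllCharsNonDesignPt₁ S) :
    U.RealisationExistsPerL₁ := by
  intro K L j _ hK _ φ hφ ι₁ hι₁ t ht V
  have hmem : ∀ i, φ 0 ∈ (t i).1 := fun i => (ht i 0).mpr (by fin_cases i <;> rfl)
  have hΨ : PairSum t := StubTree.pairSum_of_isPerLTypes K φ hφ hK t ht
  obtain ⟨D, hD⟩ := T.exists_seesawDatum_constructed hκ hs j ι₁ t hΨ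
  let c : SeesawCtx L := ⟨K, t, φ 0, D⟩
  have hc : T.GoodCtx ι₁ c := ⟨hΨ, StubTree.injective_of_isPerLTypes K φ hφ t ht, hmem, ⟨j, hι₁, hD⟩⟩
  have hSc : S c := hS c hK
  exact nonempty_thetaRealisation₁_at_allChars M T hHR V c (A.levelMeet V c hc hSc) (A.innerEmb V c hc hSc)
    (A.thetaSub V c hc hSc) (A.thetaWedge V c hc hSc) (A.thetaGen12All V c hc hSc)
    (A.thetaReal34All V c hc hSc) (A.occ V c hc hSc)

/-- **PerL from the pointwise E3 record** on any class containing the sextic contexts. -/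
theorem perL_of_pt₁ (M : U.ModelAxiomsPerL) (T : U.ThetaModel) (hHR : U.Fact_hodgeRiemann20)
    (hκ : T.Design_kappaConj) (hs : T.Design_frameSignConj) {S : ∀ {L : CMField}, SeesawCtx L → Prop}
    (hS : ∀ {L : CMField} (c : SeesawCtx L), Module.finrank ℚ c.K = 6 → S c) (A : T.AllCharsNonDesignPt₁ S) :
    U.PerL :=
  perL₁ M (realisationExistsPerL₁_of_pt M T hHR hκ hs hS A)

/-- **PerL from the E2″ record** (carvers' pointwise C1/C2) — the special case `A.toLevelMeet`. -/
theorem perL_of_pt (M : U.ModelAxiomsPerL) (T : U.ThetaModel) (hHR : U.Fact_hodgeRiemann20)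
    (hκ : T.Design_kappaConj) (hs : T.Design_frameSignConj) {S : ∀ {L : CMField}, SeesawCtx L → Prop}
    (hS : ∀ {L : CMField} (c : SeesawCtx L), Module.finrank ℚ c.K = 6 → S c) (A : T.AllCharsNonDesignPt S) :
    U.PerL :=
  perL_of_pt₁ M T hHR hκ hs hS (A.toLevelMeet M.pull_comp M.pull_cup)

end ModelAxiomsPerL

/-! ### The typed hypotheses, pointwise form (cf. the carver's `ThetaModelExistsOn` / `ThetaModelExists_sextic`) -/

variable (U) in
/-- **"A theta model exists", pointwise E3 form on the class `S`**: a convention bit, a core datum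
`C = (emb, cover, wm, Theta)`, per context the two side data, and the seven inputs of `AllCharsNonDesignPt₁ S`. -/
def ThetaModelExistsPt₁ (S : ∀ {L : CMField}, SeesawCtx L → Prop) : Prop :=
  ∃ (h : Bool) (C : U.AdelicThetaCore₀) (d12 d34 : ∀ {L : CMField}, SeesawCtx L → SideData L),
    (C.thetaModel h d12 d34).AllCharsNonDesignPt₁ S

variable (U) in
/-- **The SEXTIC-restricted pointwise E3 hypothesis** — what the model-construction sub-cell has to produce for
`W_per^L`: the seven inputs, level-meeting form, at good contexts with SEXTIC type field only, each at the `V` at hand. -/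
def ThetaModelExists_sextic₁ : Prop :=
  U.ThetaModelExistsPt₁ (fun c => Module.finrank ℚ c.K = 6)

end Universe

/-! ## 6. E3 — the END STATES, level-meeting form (global ₈; pointwise ₉ = the one for the geometric model) -/

namespace Assembly

open HodgeCM.Universe (AdelicThetaCore₀ SideData ThetaModel ModelAxiomsPerL)

variable (U : Universe)

/-- **E3: PerL, `chars` eliminated, over the FIVE model facts, with `embCover` replaced by level-meeting** —
`perL_ofSignRecipe₇'` with `(A : ….AllCharsNonDesign)` replaced by `(A : ….AllCharsNonDesign₁)`. -/
theorem perL_ofSignRecipe₈ (M : U.ModelAxiomsPerL) (h : Bool) (C : U.AdelicThetaCore₀)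
    (d12 d34 : ∀ {L : CMField}, SeesawCtx L → SideData L)
    (A : (C.thetaModel h d12 d34).AllCharsNonDesign₁) (hHR : U.Fact_hodgeRiemann20) : U.PerL :=
  M.perL_allChars₁ (C.thetaModel h d12 d34) A (C.design_kappaConj h d12 d34) (C.design_frameSignConj h d12 d34) hHR

/-- **The realisation END STATE, level-meeting form.** -/
theorem realisationExists_ofSignRecipe₈ (M : U.ModelAxiomsPerL) (h : Bool) (C : U.AdelicThetaCore₀)
    (d12 d34 : ∀ {L : CMField}, SeesawCtx L → SideData L)
    (A : (C.thetaModel h d12 d34).AllCharsNonDesign₁) (hHR : U.Fact_hodgeRiemann20) :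
    U.RealisationExistsPerL₁ ∧ U.RealisationExistsFace₁ :=
  M.realisationExists_allChars₁ (C.thetaModel h d12 d34) A (C.design_kappaConj h d12 d34)
    (C.design_frameSignConj h d12 d34) hHR

/-- **E3, POINTWISE (J-SAN final + FIX 1): PerL over the FIVE model facts from the seven inputs demanded only at
good SEXTIC-type contexts (class `S ⊇ sextic`) and at the hermitian space at hand, C1 = level-meeting, C2 = the
Petersson identity at `V`.**  This is the term the E seat instantiates for the geometric model. -/
theorem perL_ofSignRecipe₉ (M : U.ModelAxiomsPerL) (h : Bool) (C : U.AdelicThetaCore₀)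
    (d12 d34 : ∀ {L : CMField}, SeesawCtx L → SideData L) {S : ∀ {L : CMField}, SeesawCtx L → Prop}
    (hS : ∀ {L : CMField} (c : SeesawCtx L), Module.finrank ℚ c.K = 6 → S c)
    (A : (C.thetaModel h d12 d34).AllCharsNonDesignPt₁ S) (hHR : U.Fact_hodgeRiemann20) : U.PerL :=
  M.perL_of_pt₁ (C.thetaModel h d12 d34) hHR (C.design_kappaConj h d12 d34) (C.design_frameSignConj h d12 d34) hS A

/-- **E2″ (the carvers' pointwise end state, C1 = `EmbCoverAt V`)** — the special case `A.toLevelMeet` of ₉. -/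
theorem perL_ofSignRecipe₇'' (M : U.ModelAxiomsPerL) (h : Bool) (C : U.AdelicThetaCore₀)
    (d12 d34 : ∀ {L : CMField}, SeesawCtx L → SideData L) {S : ∀ {L : CMField}, SeesawCtx L → Prop}
    (hS : ∀ {L : CMField} (c : SeesawCtx L), Module.finrank ℚ c.K = 6 → S c)
    (A : (C.thetaModel h d12 d34).AllCharsNonDesignPt S) (hHR : U.Fact_hodgeRiemann20) : U.PerL :=
  perL_ofSignRecipe₉ U M h C d12 d34 hS (A.toLevelMeet M.pull_comp M.pull_cup) hHR

/-- **PerL from the sextic pointwise E3 hypothesis** (the `∃`-packaged form of ₉). -/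
theorem perL_of_thetaModelExists_sextic₁ (M : U.ModelAxiomsPerL) (hHR : U.Fact_hodgeRiemann20)
    (H : U.ThetaModelExists_sextic₁) : U.PerL := by
  obtain ⟨h, C, d12, d34, A⟩ := H
  exact perL_ofSignRecipe₉ U M h C d12 d34 (fun _ hK => hK) A hHR

/-- The global E3 end state ₈ is the case `S = ⊤` of ₉ (restriction `AllCharsNonDesign₁.pt`). -/
example (M : U.ModelAxiomsPerL) (h : Bool) (C : U.AdelicThetaCore₀)
    (d12 d34 : ∀ {L : CMField}, SeesawCtx L → SideData L)
    (A : (C.thetaModel h d12 d34).AllCharsNonDesign₁) (hHR : U.Fact_hodgeRiemann20) : U.PerL :=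
  perL_ofSignRecipe₉ U M h C d12 d34 (S := fun _ => True) (fun _ _ => trivial) (A.pt _) hHR

/-- E2′ (hence the END STATE of record E2) is the special case `A.toLevelMeet M.pull_comp M.pull_cup` of E3. -/
example (M : U.ModelAxiomsPerL) (h : Bool) (C : U.AdelicThetaCore₀)
    (d12 d34 : ∀ {L : CMField}, SeesawCtx L → SideData L)
    (A : (C.thetaModel h d12 d34).AllCharsNonDesign) (hHR : U.Fact_hodgeRiemann20) : U.PerL :=
  perL_ofSignRecipe₈ U M h C d12 d34 (A.toLevelMeet M.pull_comp M.pull_cup) hHR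

example (M : U.ModelAxioms) (h : Bool) (C : U.AdelicThetaCore₀)
    (d12 d34 : ∀ {L : CMField}, SeesawCtx L → SideData L)
    (A : (C.thetaModel h d12 d34).AllCharsNonDesign) (hHR : U.Fact_hodgeRiemann20) : U.PerL :=
  perL_ofSignRecipe₈ U M.toPerL h C d12 d34 (A.toLevelMeet M.pull_comp M.pull_cup) hHR

end Assembly
end HodgeCM
end
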